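import Mathlib
import Summits.AtomisticToContinuum.HydrodynamicLimit.Theses.JParityClosure
import Summits.AtomisticToContinuum.HydrodynamicLimit.Theses.SpacetimeExtensivity
import Literature.Analysis.FluidPDE.InfiniteHardSphereDynamics

/-!
# Sketch — first lemmas of three crux ideas for `RateFloor` (stmt-AtomisticToContinuum-13080)
ideator 2, round 1.  Nothing here is proved; the point is that the signatures elaborate over
existing declarations.
-/

noncomputable section

open scoped InnerProductSpace RealInnerProductSpace BigOperators ENNReal
open MeasureTheory Filter Set Topology

namespace Summit.AtomisticToContinuum.HydrodynamicLimit.Cruxes.RateFloor.IdeatorTwo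

abbrev E3 := EuclideanSpace ℝ (Fin 3)

/-! ## Idea A (aimed-shell capture census): the ballistic capture lemma -/

/-- **Ballistic capture.** Free relative motion `q(t) = q₀ + t • g` that enters the sphere of
radius `R` (`‖q₀‖ = R`) while incoming (`⟪q₀, g⟫ < 0`) with impact parameter below `ε ≤ R`
(`‖q₀‖²‖g‖² − ⟪q₀,g⟫² < ε²‖g‖²`, i.e. `b = ‖q₀ × ĝ‖ < ε`) reaches the contact sphere `‖q‖ = ε`,
still incoming, before the pericentre time `−⟪q₀,g⟫/‖g‖²`, and stays outside the core before.
This is the kinematic half of the census "collisions = aimed inward shell crossings − interrupted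
ones". [folklore] -/
theorem stub_ballisticCapture (q₀ g : E3) {ε R : ℝ} (hε : 0 < ε) (hεR : ε ≤ R)
    (hq : ‖q₀‖ = R) (hin : ⟪q₀, g⟫_ℝ < 0)
    (haim : ‖q₀‖ ^ 2 * ‖g‖ ^ 2 - ⟪q₀, g⟫_ℝ ^ 2 < ε ^ 2 * ‖g‖ ^ 2) :
    ∃ t : ℝ, 0 ≤ t ∧ t * ‖g‖ ^ 2 < -⟪q₀, g⟫_ℝ ∧ ‖q₀ + t • g‖ = ε ∧ ⟪q₀ + t • g, g⟫_ℝ < 0 ∧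
      ∀ s : ℝ, 0 ≤ s → s < t → ε < ‖q₀ + s • g‖ := by
  sorry

/-- **Radial pair virial is monotone in free flight**: `t ↦ ⟪q₀ + t g, g⟫` is non-decreasing
(derivative `‖g‖² ≥ 0`); together with the `+2ε|g·n̂|` jump at the pair's own collision this is
the monotone quantity behind the shell census (only third-party collisions can decrease it).
[folklore] -/
theorem stub_pairVirial_monotone (q₀ g : E3) : Monotone fun t : ℝ => ⟪q₀ + t • g, g⟫_ℝ := by
  sorry

/-- **Census at trajectory level (signature only).** For a hard-sphere trajectory on `𝕋³`, if on
`(t₀, t₁]` neither `i` nor `j` is in contact with a third particle, and at `t₀` the pair is an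
aimed incoming pair at separation `R` (minimal image, `2R < 1/2`), then the pair collides in
`(t₀, t₀ + R/… ]`: there is a collision time `t ∈ (t₀, t₁]` with `i, j` in contact, provided
`t₁ - t₀` exceeds the capture time.  Stated over `IsHardSphereTrajectory`; the proof is
`stub_ballisticCapture` + `IsHardSphereTrajectory.free` (free flight until the first contact) +
continuity of positions. [folklore] -/
theorem stub_census_capture {N : ℕ} {ε R : ℝ} (hε : 0 < ε) (hεR : ε ≤ R) (hR : 2 * R < 2⁻¹)
    {γ : ℝ → Literature.Analysis.FluidPDE.Config N (Fin 3) (UnitAddTorus (Fin 3))}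
    (hγ : Literature.Analysis.FluidPDE.IsHardSphereTrajectory
      (Literature.Analysis.FluidPDE.Torus.geometry (Fin 3)) ε N γ)
    {i j : Fin N} (hij : i ≠ j) {t₀ t₁ : ℝ} (ht : t₀ < t₁)
    (hthird : ∀ t ∈ Set.Ioc t₀ t₁, ∀ k : Fin N, k ≠ i → k ≠ j →
      γ t ∉ Literature.Analysis.FluidPDE.contactSet (Literature.Analysis.FluidPDE.Torus.geometry (Fin 3)) N ε i k ∧
      γ t ∉ Literature.Analysis.FluidPDE.contactSet (Literature.Analysis.FluidPDE.Torus.geometry (Fin 3)) N ε j k)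
    (hsep : ‖(Literature.Analysis.FluidPDE.Torus.geometry (Fin 3)).sepVec (γ t₀ i).1 (γ t₀ j).1‖ = R)
    (hin : ⟪(Literature.Analysis.FluidPDE.Torus.geometry (Fin 3)).sepVec (γ t₀ i).1 (γ t₀ j).1,
      (γ t₀ i).2 - (γ t₀ j).2⟫_ℝ < 0)
    (haim : R ^ 2 * ‖(γ t₀ i).2 - (γ t₀ j).2‖ ^ 2 -
      ⟪(Literature.Analysis.FluidPDE.Torus.geometry (Fin 3)).sepVec (γ t₀ i).1 (γ t₀ j).1,
        (γ t₀ i).2 - (γ t₀ j).2⟫_ℝ ^ 2 < ε ^ 2 * ‖(γ t₀ i).2 - (γ t₀ j).2‖ ^ 2)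
    (hlong : (t₁ - t₀) * ‖(γ t₀ i).2 - (γ t₀ j).2‖ ^ 2 ≥
      -⟪(Literature.Analysis.FluidPDE.Torus.geometry (Fin 3)).sepVec (γ t₀ i).1 (γ t₀ j).1,
        (γ t₀ i).2 - (γ t₀ j).2⟫_ℝ) :
    ∃ t ∈ Set.Ioc t₀ t₁, t ∈ Literature.Analysis.FluidPDE.collisionTimes
        (Literature.Analysis.FluidPDE.Torus.geometry (Fin 3)) ε γ ∧
      γ t ∈ Literature.Analysis.FluidPDE.contactSet
        (Literature.Analysis.FluidPDE.Torus.geometry (Fin 3)) N ε i j := by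
  sorry

/-! ## Idea B (equilibrium deficit transfer): the transfer step -/

/-- **Transfer of a superexponentially rare equilibrium event.**  The static L² budget of the
tree item `SpacetimeExtensivity.TransferInequality` (stmt-3924, provable now:
`LG(S)² ≤ e^{C(N+1)}·G(S)`) kills, under the local Gibbs law, every family of events whose
probability under the flow-invariant homogeneous Gibbs law `G = localGibbsLaw σ 1 0 θe` decays
like `exp(−c_N (N+1))` with `c_N → ∞`.  Pure `ℝ≥0∞` bookkeeping; the content of the line is the
superexponential equilibrium LOWER-tail bound for cut collision functionals fed into `hG`.
[folklore] -/
theorem stub_transfer_superexp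
    (LG G : (N : ℕ) → Measure (Literature.Analysis.FluidPDE.Config (N + 1) (Fin 3)
      Literature.MathematicalPhysics.KineticTheory.T3))
    (S : (N : ℕ) → Set (Literature.Analysis.FluidPDE.Config (N + 1) (Fin 3)
      Literature.MathematicalPhysics.KineticTheory.T3))
    {C : ℝ} (hbudget : ∀ N, LG N (S N) ^ 2 ≤ ENNReal.ofReal (Real.exp (C * (N + 1))) * G N (S N))
    (c : ℕ → ℝ) (hc : Tendsto c atTop atTop)
    (hG : ∀ N, G N (S N) ≤ ENNReal.ofReal (Real.exp (-(c N * (N + 1))))) :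
    Tendsto (fun N => LG N (S N)) atTop (𝓝 0) := by
  sorry

/-- **Residence in mean free times diverges.**  In the conjunct's scaling a particle crossing a
macroscopic ball of radius `ρ` at speed `≤ V` spends at least `ρ/V` macroscopic time there, i.e.
`(ρ/V)·(N+1)^{1/3}·σ²·c₀` ideal mean free times — unbounded in `N`.  (Elementary; recorded because
it is the scaling fact that makes a SUSTAINED local collision deficit superexponentially costly in
equilibrium.) [folklore] -/
theorem stub_residence_mft_diverges {ρ V σ c₀ : ℝ} (hρ : 0 < ρ) (hV : 0 < V) (hσ : 0 < σ)
    (hc₀ : 0 < c₀) :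
    Tendsto (fun N : ℕ => ρ / V * (((N : ℝ) + 1) ^ ((1 : ℝ) / 3) * σ ^ 2 * c₀)) atTop atTop := by
  sorry

/-! ## Idea C (no-screening of stationary limit states): the impact-flatness kernel -/

/-- **Cap-ratio (impact flatness from direction isotropy).**  Directions making angle `< arctan
(a/D)` with the line of sight form a spherical cap of normalised area `1 − (1 + (a/D)²)^{-1/2}`;
for `0 < ε ≤ R ≤ D` the cap hitting the inner disc of radius `ε` has at least the fraction
`(ε/R)²` of the cap hitting the disc of radius `R`.  So a particle whose direction was
re-randomised by its last deflection at distance `D ≥ R` (hard-sphere scattering is isotropic in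
the centre-of-mass frame) lands in the aimed sub-disc with conditional probability `≥ (c/C)(ε/R)²`
when its direction density lies in `[c, C]` × uniform. [folklore] -/
theorem stub_capRatio {ε R D : ℝ} (hε : 0 < ε) (hεR : ε ≤ R) (hRD : R ≤ D) :
    (ε / R) ^ 2 * (1 - (Real.sqrt (1 + (R / D) ^ 2))⁻¹) ≤ 1 - (Real.sqrt (1 + (ε / D) ^ 2))⁻¹ := by
  sorry

/-- **Stationarity of space–time local laws (OVY Lemma 4.1 shape, hard spheres).**  Signature of
the compactness/stationarity input of idea C over the tree's infinite-volume vocabulary: every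
weak limit point `Q` of the time-averaged local laws `localLawTimeAvg` of the torus hard-sphere
flows under laws of bounded entropy per particle is translation invariant and is stationary for
some infinite hard-sphere flow.  (Hypotheses abbreviated to the objects; the real item quantifies
the entropy bound and the blow-up scale `ε_N = hsDiameter σ N`.) [cite: OllaVaradhanYau1993, §4 Lemma 4.1] -/
def StationaryLocalLimits (σ : ℝ) : Prop :=
  ∀ (P₀ : (N : ℕ) → Measure (Literature.Analysis.FluidPDE.Config (N + 1) (Fin 3)
      Literature.MathematicalPhysics.KineticTheory.T3))
    (Φ : (N : ℕ) → Literature.Analysis.FluidPDE.HardSphereFlow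
      (Literature.Analysis.FluidPDE.Torus.geometry (Fin 3))
      (Literature.MathematicalPhysics.KineticTheory.hsDiameter σ N) (N + 1))
    (T₀ : ℝ) (Q : Measure (Literature.Analysis.FunctionSpaces.PointConfig (E3 × E3))),
    0 < T₀ →
    (∃ C : ℝ, ∀ N, ∀ Ψ, InformationTheory.klDiv (P₀ N)
        (Literature.MathematicalPhysics.KineticTheory.localGibbsLaw σ (fun _ => 1) (fun _ => 0)
          (fun _ => 1) N Ψ) ≤ ENNReal.ofReal (C * (N + 1))) →
    (∃ φ : ℕ → ℕ, StrictMono φ ∧ ∀ A, MeasurableSet A →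
      Tendsto (fun k => Literature.Analysis.FluidPDE.localLawTimeAvg (Φ (φ k))
        (Literature.MathematicalPhysics.KineticTheory.hsDiameter σ (φ k)) (P₀ (φ k)) T₀ A)
        atTop (𝓝 (Q A))) →
    Literature.Analysis.FluidPDE.IsTranslationInvariant Q ∧
      ∃ Ψ : Literature.Analysis.FluidPDE.InfiniteHardSphereFlow (Fin 3) 1, Ψ.IsStationary Q

end Summit.AtomisticToContinuum.HydrodynamicLimit.Cruxes.RateFloor.IdeatorTwo
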